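import Mathlib
import HarnessLib
import Summits.ResolutionOfSingularities.ResolutionOfSingularities.Theorems.HomologicalConductorNoZenoStableEnd
import Summits.ResolutionOfSingularities.ResolutionOfSingularities.Theorems.HomologicalConductorNoZenoHighSyzygyDualExtVanishing

/-!
# Crux `NoZenoR` / `NoZeno` (stmt-ResolutionOfSingularities-19943 / -16483), line
# `sandwich-cluster`, S3 Layer 2 — Ga-assembly glue: `ca(T) = ⨅_{L ∈ Ωⁿ⁻¹(mod T)} ann_T End̲(L*)`

Route `ResolutionOfSingularities/HomologicalConductor`.  OURS (cell res-hironaka, crux chain W4.4,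
seat res-L0-w44-stub-5 = res-D-pv-037; object named by res-L0-w44-lead-1, RULINGS (2) item (3),
2026-08-27T05:42:06Z: `ca_eq_iInf_stableAnn`); nothing here is a statement of the manuscript under
review (Hironaka 2017); AI-written, weaker than expert review.

The CA side of THEOREM A (Ga = `Sig.stubG_caCarried`, skeleton v16/v18) in the ONE shape the lead's
assembly consumes: the cohomology annihilator of `T` is the intersection, over an INDEX TYPE
`HighSyzygyDatum T n` of «duals of `(n-1)`-st syzygies of finitely generated modules», of the
annihilators of the stable endomorphism modules `End̲(L*) = StableEnd T (Dual T L)` — exactly a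
family `H : Λ → Type` of `T`-modules as in `CycleLattice.exists_iInf_annihilator_eq` (stub-8,
p497943) — together with the membership facts each member carries into stub-8's G2-MAIN
`exists_locallyFree_stableEnd_equiv_cechMH1` (f.g., reflexive, `Ext¹(·, T) = 0`).

* `HighSyzygyDatum T n` — the index type: a finitely generated `M` with an `(n-1)`-st syzygy `L`
  (`nonempty_highSyzygyDatum`: it is inhabited over a noetherian ring);
* `mem_cohomologyAnnihilatorOfDegree_iff_forall_datum`, `cohomologyAnnihilatorOfDegree_eq_iInf` —
  over a noetherian DOMAIN and for `n ≥ 3`: `caⁿ(T) = ⨅_d ann_T End̲((d.L)*)` (CA4 p498577 + CA5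
  p500785);
* `exists_forall_le_cohomologyAnnihilator_eq` — the stabilisation index: `ca(T) = caⁿ(T)` for all
  `n ≥ s`;
* **`ca_eq_iInf_stableAnn`** — `ca(T) = ⨅_d ann_T End̲((d.L)*)` for every `n ≥ 3` past the
  stabilisation index, and **`exists_ca_eq_iInf_stableAnn`** — the packaged choice `n := max s 4`
  (so that the (W)-rider applies, tri-1 F1);
* membership facts for `d : HighSyzygyDatum T n`: `finite_dual` (noetherian), `isReflexive` /
  `isReflexive_dual` (domain, `n ≥ 3`), `ext_one_dual_eq_zero` (two-dimensional normal local,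
  `n ≥ 4`; = the discharged rider p502336), and `cohomologyAnnihilator_le_annihilator` (each
  `ann_T End̲(L*)` contains `ca(T)`, hence `𝔪^c` — the common bound CycleLattice wants);
* `highSyzygyDuals T n : Set (ModuleCat T)`, `ca_eq_biInf_stableAnn`, `highSyzygyDuals_spec` — the
  same family and theorem indexed by a `Set` of modules.
-/

noncomputable section

-- single-problem summit: the doubled namespace component `ResolutionOfSingularities` is forced
set_option linter.dupNamespace false

namespace Summit.ResolutionOfSingularities.ResolutionOfSingularities.Theorems.NoZeno.SandwichCluster

open CategoryTheory CategoryTheory.Abelian Literature.RingTheory.CohomologyAnnihilator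

universe u

variable (T : Type u) [CommRing T]

/-! ## The index type of the family `{L* : L ∈ Ωⁿ⁻¹(mod T)}` -/

/-- A HIGH-SYZYGY DATUM of level `n`: a finitely generated `T`-module `M` together with an
`(n-1)`-st syzygy module `L` of `M` (`IsSyzygy (n - 1) M L`).  The family of THEOREM A is
`d ↦ (d.L)* = Module.Dual T d.L`, read through `StableEnd T (Module.Dual T d.L)`. [this work] -/
structure HighSyzygyDatum (n : ℕ) : Type (u + 1) where
  /-- the finitely generated module -/
  M : ModuleCat.{u} T
  /-- an `(n-1)`-st syzygy module of `M` -/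
  L : ModuleCat.{u} T
  /-- `M` is finitely generated -/
  finite : Module.Finite T M
  /-- `L ∈ Ωⁿ⁻¹(M)` -/
  isSyzygy : IsSyzygy (n - 1) M L

variable {T}

/-- The index type is inhabited over a noetherian ring (`T` itself has syzygies of every order).
[folklore] -/
theorem nonempty_highSyzygyDatum [IsNoetherianRing T] (n : ℕ) : Nonempty (HighSyzygyDatum T n) := by
  obtain ⟨K, -, hK⟩ := exists_isSyzygy (ModuleCat.of T T) (n - 1)
  exact ⟨⟨ModuleCat.of T T, K, inferInstance, hK⟩⟩

/-! ## `caⁿ(T)` as an intersection of annihilators of stable endomorphism modules -/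

/-- Over a noetherian DOMAIN and for `n ≥ 3`: `x ∈ caⁿ(T)` iff `x` annihilates `End̲(L*)` for every
high-syzygy datum `(M, L)` of level `n` (CA4
`mem_cohomologyAnnihilatorOfDegree_iff_forall_dual_syzygy` + CA5
`stablyAnnihilates_iff_mem_annihilator_stableEnd`). [folklore] -/
theorem mem_cohomologyAnnihilatorOfDegree_iff_forall_datum [IsNoetherianRing T] [IsDomain T] {n : ℕ}
    (hn : 3 ≤ n) (x : T) :
    x ∈ cohomologyAnnihilatorOfDegree T n ↔
      ∀ d : HighSyzygyDatum T n, x ∈ Module.annihilator T (StableEnd T (Module.Dual T d.L)) := by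
  rw [mem_cohomologyAnnihilatorOfDegree_iff_forall_dual_syzygy hn]
  constructor
  · intro h d
    exact (stablyAnnihilates_iff_mem_annihilator_stableEnd x).mp (h d.M d.L d.finite d.isSyzygy)
  · intro h M L hM hL
    exact (stablyAnnihilates_iff_mem_annihilator_stableEnd x).mpr (h ⟨M, L, hM, hL⟩)

/-- Over a noetherian domain and for `n ≥ 3`: `caⁿ(T) = ⨅_d ann_T End̲((d.L)*)`. [folklore] -/
theorem cohomologyAnnihilatorOfDegree_eq_iInf [IsNoetherianRing T] [IsDomain T] {n : ℕ}
    (hn : 3 ≤ n) :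
    cohomologyAnnihilatorOfDegree T n =
      ⨅ d : HighSyzygyDatum T n, Module.annihilator T (StableEnd T (Module.Dual T d.L)) := by
  ext x
  rw [mem_cohomologyAnnihilatorOfDegree_iff_forall_datum hn, Submodule.mem_iInf]

/-! ## Stabilisation and the theorem the assembly consumes -/

/-- The stabilisation index of the tower `caⁿ(T)` over a noetherian ring: `ca(T) = caⁿ(T)` for
every `n ≥ s`. [cite: IyengarTakahashi2014, Definition 2.1] -/
theorem exists_forall_le_cohomologyAnnihilator_eq [IsNoetherianRing T] :
    ∃ s : ℕ, ∀ n : ℕ, s ≤ n → cohomologyAnnihilator T = cohomologyAnnihilatorOfDegree T n := by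
  obtain ⟨s, hs⟩ := exists_cohomologyAnnihilator_eq_of_isNoetherianRing (R := T)
  refine ⟨s, fun n hn => le_antisymm ?_ (cohomologyAnnihilatorOfDegree_le n)⟩
  rw [hs]
  exact cohomologyAnnihilatorOfDegree_mono hn

/-- **`ca(T) = ⨅_{L ∈ Ωⁿ⁻¹(mod T)} ann_T End̲(L*)`** (CRUX-PLAN v4.0.2 §1.3, first display): over a
noetherian domain, for any `n ≥ 3` at which the tower has stabilised (`ca(T) = caⁿ(T)`), the
cohomology annihilator is the intersection over all high-syzygy data of level `n` of the
annihilators of the stable endomorphism modules of the duals. [folklore] -/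
theorem ca_eq_iInf_stableAnn [IsNoetherianRing T] [IsDomain T] {n : ℕ} (hn : 3 ≤ n)
    (hca : cohomologyAnnihilator T = cohomologyAnnihilatorOfDegree T n) :
    cohomologyAnnihilator T =
      ⨅ d : HighSyzygyDatum T n, Module.annihilator T (StableEnd T (Module.Dual T d.L)) := by
  rw [hca, cohomologyAnnihilatorOfDegree_eq_iInf hn]

/-- Membership form of `ca_eq_iInf_stableAnn` — the shape `∀ L, x ∈ ann_T (H L)` of
`CycleLattice.exists_iInf_annihilator_eq`. [folklore] -/
theorem mem_cohomologyAnnihilator_iff_forall_datum [IsNoetherianRing T] [IsDomain T] {n : ℕ}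
    (hn : 3 ≤ n) (hca : cohomologyAnnihilator T = cohomologyAnnihilatorOfDegree T n) (x : T) :
    x ∈ cohomologyAnnihilator T ↔
      ∀ d : HighSyzygyDatum T n, x ∈ Module.annihilator T (StableEnd T (Module.Dual T d.L)) := by
  rw [hca, mem_cohomologyAnnihilatorOfDegree_iff_forall_datum hn]

/-- **The packaged choice `n := max s 4`**: over a noetherian domain there is a level `n ≥ 4` with
`ca(T) = caⁿ(T) = ⨅_d ann_T End̲((d.L)*)` over the high-syzygy data of level `n` — `n ≥ 4` so that
every member also satisfies the (W)-rider (`HighSyzygyDatum.ext_one_dual_eq_zero`). [folklore] -/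
theorem exists_ca_eq_iInf_stableAnn [IsNoetherianRing T] [IsDomain T] :
    ∃ n : ℕ, 4 ≤ n ∧ cohomologyAnnihilator T = cohomologyAnnihilatorOfDegree T n ∧
      cohomologyAnnihilator T =
        ⨅ d : HighSyzygyDatum T n, Module.annihilator T (StableEnd T (Module.Dual T d.L)) := by
  obtain ⟨s, hs⟩ := exists_forall_le_cohomologyAnnihilator_eq (T := T)
  refine ⟨max s 4, le_max_right _ _, hs _ (le_max_left _ _), ?_⟩
  exact ca_eq_iInf_stableAnn (by omega) (hs _ (le_max_left _ _))

/-! ## What each member of the family carries -/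

namespace HighSyzygyDatum

variable {n : ℕ}

/-- `L*` is finitely generated (noetherian `T`). [folklore] -/
theorem finite_dual [IsNoetherianRing T] (d : HighSyzygyDatum T n) :
    Module.Finite T (Module.Dual T d.L) :=
  finite_dual_of_isSyzygy d.finite d.isSyzygy

/-- `L` is finitely generated (noetherian `T`). [folklore] -/
theorem finite_L [IsNoetherianRing T] (d : HighSyzygyDatum T n) : Module.Finite T d.L :=
  finite_of_isSyzygy (n - 1) d.finite d.isSyzygy

/-- `L` is reflexive (domain, `n ≥ 3`: `L ∈ Ω^{≥ 2}`). [folklore] -/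
theorem isReflexive [IsDomain T] (hn : 3 ≤ n) (d : HighSyzygyDatum T n) :
    Module.IsReflexive T d.L :=
  isReflexive_of_isSyzygy_of_two_le (by omega) d.isSyzygy

/-- `L*` is reflexive (domain, `n ≥ 3`). [folklore] -/
theorem isReflexive_dual [IsDomain T] (hn : 3 ≤ n) (d : HighSyzygyDatum T n) :
    Module.IsReflexive T (Module.Dual T d.L) :=
  isReflexive_dual_of_isSyzygy (s := n - 1) (by omega) d.isSyzygy

/-- **(W) for the member**: over a two-dimensional noetherian local normal domain and for `n ≥ 4`,
`Ext¹_T(L*, T) = 0` (the discharged rider `ext_one_dual_eq_zero_of_isSyzygy_pred`, p502336; FALSE at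
`n = 3`, tri-1 F1). [cite: IyamaWemyss2009, Thm. 2.7] -/
theorem ext_one_dual_eq_zero [IsDomain T] [IsNoetherianRing T] [IsLocalRing T]
    [IsIntegrallyClosed T] (hdim : ringKrullDim T = 2) (hn : 4 ≤ n) (d : HighSyzygyDatum T n)
    (e : Ext.{u} (ModuleCat.of T (Module.Dual T d.L)) (ModuleCat.of T T) 1) : e = 0 :=
  ext_one_dual_eq_zero_of_isSyzygy_pred hdim hn d.finite d.isSyzygy e

/-- `x` stably annihilates `L*` iff `x` annihilates `End̲(L*)` (CA5, recorded on the datum).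
[folklore] -/
theorem stablyAnnihilates_dual_iff (d : HighSyzygyDatum T n) (x : T) :
    StablyAnnihilates T x (ModuleCat.of T (Module.Dual T d.L)) ↔
      x ∈ Module.annihilator T (StableEnd T (Module.Dual T d.L)) :=
  stablyAnnihilates_iff_mem_annihilator_stableEnd x

/-- Each `ann_T End̲(L*)` contains `ca(T)` once the tower has stabilised at the level `n ≥ 3` of the
datum — so every member's annihilator contains the `𝔪`-primary ideal `ca(T)` (the common bound the
cycle lattice wants). [folklore] -/
theorem cohomologyAnnihilator_le_annihilator [IsNoetherianRing T] [IsDomain T] (hn : 3 ≤ n)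
    (hca : cohomologyAnnihilator T = cohomologyAnnihilatorOfDegree T n) (d : HighSyzygyDatum T n) :
    cohomologyAnnihilator T ≤ Module.annihilator T (StableEnd T (Module.Dual T d.L)) := by
  rw [ca_eq_iInf_stableAnn hn hca]
  exact iInf_le _ d

/-- Without stabilisation: `caⁿ(T) ≤ ann_T End̲(L*)` for every datum of level `n ≥ 3`. [folklore] -/
theorem cohomologyAnnihilatorOfDegree_le_annihilator [IsNoetherianRing T] [IsDomain T] (hn : 3 ≤ n)
    (d : HighSyzygyDatum T n) :
    cohomologyAnnihilatorOfDegree T n ≤ Module.annihilator T (StableEnd T (Module.Dual T d.L)) := by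
  rw [cohomologyAnnihilatorOfDegree_eq_iInf hn]
  exact iInf_le _ d

end HighSyzygyDatum


/-! ## The same family as a `Set` of modules -/

/-- The family of THEOREM A as a SET of `T`-modules: the duals `L*` (as objects of `ModuleCat T`) of
the `(n-1)`-st syzygies `L` of finitely generated modules. [this work] -/
def highSyzygyDuals (T' : Type u) [CommRing T'] (n : ℕ) : Set (ModuleCat.{u} T') :=
  Set.range fun d : HighSyzygyDatum T' n => ModuleCat.of T' (Module.Dual T' d.L)
-- (explicit ring argument: consumers write `highSyzygyDuals T n`)

/-- `ca(T) = ⨅_{N ∈ highSyzygyDuals T n} ann_T End̲(N)` — the `Set`-indexed form of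
`ca_eq_iInf_stableAnn`. [folklore] -/
theorem ca_eq_biInf_stableAnn [IsNoetherianRing T] [IsDomain T] {n : ℕ} (hn : 3 ≤ n)
    (hca : cohomologyAnnihilator T = cohomologyAnnihilatorOfDegree T n) :
    cohomologyAnnihilator T =
      ⨅ N ∈ highSyzygyDuals T n, Module.annihilator T (StableEnd T N) := by
  rw [ca_eq_iInf_stableAnn hn hca, highSyzygyDuals, iInf_range]

/-- Every member of `highSyzygyDuals T n` is finitely generated (noetherian `T`), reflexive (domain,
`n ≥ 3`) and, over a two-dimensional noetherian local normal domain with `n ≥ 4`, has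
`Ext¹_T(N, T) = 0` — the hypotheses of stub-8's G2-MAIN. [folklore] -/
theorem highSyzygyDuals_spec [IsDomain T] [IsNoetherianRing T] [IsLocalRing T]
    [IsIntegrallyClosed T] (hdim : ringKrullDim T = 2) {n : ℕ} (hn : 4 ≤ n) {N : ModuleCat.{u} T}
    (hN : N ∈ highSyzygyDuals T n) :
    Module.Finite T N ∧ Module.IsReflexive T N ∧ ∀ e : Ext.{u} N (ModuleCat.of T T) 1, e = 0 := by
  obtain ⟨d, rfl⟩ := hN
  exact ⟨d.finite_dual, d.isReflexive_dual (by omega), d.ext_one_dual_eq_zero hdim hn⟩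


/-! ## A `Type`-small re-indexing of the family (for `caCarried_of_pieces`)

The index type `HighSyzygyDatum T n` carries objects of `ModuleCat.{u} T` and therefore lives in
`Type (u+1)`; the lead's Ga assembly `caCarried_of_pieces` (`…NoZenoCaCarriedAssembly.lean`)
binds its family as `{ιN : Type} (N : ιN → Type)`.  Re-index by the SET OF ANNIHILATOR IDEALS that
occur — a subtype of `Ideal T`, small — choosing for each ideal one module of the family realising
it. -/

variable (T) in
/-- The set of ideals `ann_T End̲(L*)` over the high-syzygy data of level `n` (a subset of
`Ideal T`, hence a `Type u`-small index for the family). [this work] -/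
def stableAnnIdeals (n : ℕ) : Set (Ideal T) :=
  Set.range fun d : HighSyzygyDatum T n => Module.annihilator T (StableEnd T (Module.Dual T d.L))

/-- A high-syzygy datum realising the ideal `j ∈ stableAnnIdeals T n` (by choice). [this work] -/
def stableAnnDatum {n : ℕ} (j : stableAnnIdeals T n) : HighSyzygyDatum T n :=
  Classical.choose j.2

/-- The module `L*` of a datum realising the ideal `j` — the family `N : stableAnnIdeals T n → Type`
handed to `caCarried_of_pieces`. [this work] -/
abbrev stableAnnModule {n : ℕ} (j : stableAnnIdeals T n) : Type u :=
  Module.Dual T (stableAnnDatum j).L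

/-- The chosen module realises the ideal: `ann_T End̲(N j) = j`. [this work] -/
theorem annihilator_stableEnd_stableAnnModule {n : ℕ} (j : stableAnnIdeals T n) :
    Module.annihilator T (StableEnd T (stableAnnModule j)) = (j : Ideal T) :=
  Classical.choose_spec j.2

/-- **`hca` in the shape of `caCarried_of_pieces`**: over a noetherian domain, for `n ≥ 3` past the
stabilisation index, `t ∈ ca(T)` iff `t` annihilates `End̲(N j)` for every `j` in the `Type`-small
index `stableAnnIdeals T n`. [folklore] -/
theorem mem_cohomologyAnnihilator_iff_forall_stableAnnIdeals [IsNoetherianRing T] [IsDomain T]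
    {n : ℕ} (hn : 3 ≤ n) (hca : cohomologyAnnihilator T = cohomologyAnnihilatorOfDegree T n)
    (t : T) :
    t ∈ cohomologyAnnihilator T ↔
      ∀ j : stableAnnIdeals T n, t ∈ Module.annihilator T (StableEnd T (stableAnnModule j)) := by
  rw [mem_cohomologyAnnihilator_iff_forall_datum hn hca]
  constructor
  · intro h j
    exact h (stableAnnDatum j)
  · intro h d
    have hj : Module.annihilator T (StableEnd T (Module.Dual T d.L)) ∈ stableAnnIdeals T n :=
      ⟨d, rfl⟩
    have := h ⟨_, hj⟩
    rwa [annihilator_stableEnd_stableAnnModule] at this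

/-- The packaged choice `n := max s 4` in the `Type`-small indexing: `∃ n ≥ 4` with `ca(T) = caⁿ(T)`
and `t ∈ ca(T) ↔ ∀ j : stableAnnIdeals T n, t ∈ ann_T End̲(N j)`. [folklore] -/
theorem exists_mem_cohomologyAnnihilator_iff_forall_stableAnnIdeals [IsNoetherianRing T]
    [IsDomain T] :
    ∃ n : ℕ, 4 ≤ n ∧ cohomologyAnnihilator T = cohomologyAnnihilatorOfDegree T n ∧
      ∀ t : T, t ∈ cohomologyAnnihilator T ↔
        ∀ j : stableAnnIdeals T n, t ∈ Module.annihilator T (StableEnd T (stableAnnModule j)) := by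
  obtain ⟨s, hs⟩ := exists_forall_le_cohomologyAnnihilator_eq (T := T)
  refine ⟨max s 4, le_max_right _ _, hs _ (le_max_left _ _), fun t => ?_⟩
  exact mem_cohomologyAnnihilator_iff_forall_stableAnnIdeals (by omega) (hs _ (le_max_left _ _)) t

/-- Member facts for the re-indexed family, in the shape G2-MAIN consumes: `N j` is finitely
generated and reflexive (`n ≥ 3`), and over a two-dimensional noetherian local normal domain with
`n ≥ 4` it has `Ext¹_T(N j, T) = 0`. [folklore] -/
theorem stableAnnModule_spec [IsDomain T] [IsNoetherianRing T] [IsLocalRing T]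
    [IsIntegrallyClosed T] (hdim : ringKrullDim T = 2) {n : ℕ} (hn : 4 ≤ n)
    (j : stableAnnIdeals T n) :
    Module.Finite T (stableAnnModule j) ∧ Module.IsReflexive T (stableAnnModule j) ∧
      ∀ e : Ext.{u} (ModuleCat.of T (stableAnnModule j)) (ModuleCat.of T T) 1, e = 0 :=
  ⟨(stableAnnDatum j).finite_dual, (stableAnnDatum j).isReflexive_dual (by omega),
    (stableAnnDatum j).ext_one_dual_eq_zero hdim hn⟩

/-- `N j` is finitely generated (noetherian `T`; any level). [folklore] -/
theorem finite_stableAnnModule [IsNoetherianRing T] {n : ℕ} (j : stableAnnIdeals T n) :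
    Module.Finite T (stableAnnModule j) :=
  (stableAnnDatum j).finite_dual

end Summit.ResolutionOfSingularities.ResolutionOfSingularities.Theorems.NoZeno.SandwichCluster

end
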